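import Summits.AtomisticToContinuum.Crystallization.Theorems.FrustratedLawDichotomyStrainedPatchCoreTube

/-!
# «CoreTube», sequel: the bridge at the core radius and the record nodes (lens-5 g47; §3–§4 of the node, split off under the 400-line lint, critic ROW 841 (5))

Prequel `…Theorems.FrustratedLawDichotomyStrainedPatchCoreTube` (§1–§2) cuts the gradient residual `[OT-G] = MonoOffTubeFloor (63/10) (63/10) (1/100) (1/1000)`
EXACTLY into the core-far piece `CoreOffTubeFloor r r₁ ρ ε φ` [RESIDUAL] and the rim piece `RimOffTubeFloor …`, and discharges the rim inside the core-tube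
piece `MonoCoreTubeFloor r r₁ ρ ε φ`.  THIS FILE proves the core-tube piece from the tree's bridge vocabulary and assembles the record node:
§3 the far tail `tailOut R` is SIGNED on members for `R ≥ 17/5` (`tailOut_nonpos_of_mem`, from `lennardJones_nonpos`, `omega₂_of_two_le`, `w₄₅_mem`), hence (H)
`HomFloor m` survives truncation to the core (`HomCoreFloor ρ m`), and with the g45 literal `TailPenalty ρ μ` and a core-relief allowance `CoreCoreRelief r r₁ ρ ε A`
the seam `φ + A + μ ≤ m` gives `MonoCoreTubeFloor r r₁ ρ ε φ`; §4 the record node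
`StrainedPatchRec ⟸ HomFloor (1/625) ∧ TailPenalty (24/5) (1/1000) ∧ CoreCoreRelief (63/10)(63/10)(24/5)(1/100)(3/5000) ∧ CoreOffTubeFloor (63/10)(63/10)(24/5)(1/100)(1/1000)
∧ AnnularPhaseFloor (63/10)(24/5)(63/10)(1/1000) ∧ PolyTextureFloor (63/10)(24/5)(1/1000) ∧ AnnularDefectFloor (24/5)(63/10) ∧ DefectiveCollarFloor (24/5)`
(`seam_arith_core : 3/5000 + 1/1000 ≤ 1/625` is the ONE place where the three literals meet — zero slack, critic ROW 841 (2)), the g46 nodes recovered.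
No sorry, no new axioms, no cite tokens, no instances / notation.  Evidence: `run/shared/lean/pub/decomp-a2c/decomp-a2c-lens-5/g47/`.
-/

namespace Summit.AtomisticToContinuum.Crystallization.Theorems.FrustratedLawDichotomyStrainedPatchCoreTubeRecord

open scoped BigOperators Classical
open Literature.MathematicalPhysics.StatisticalMechanics (lennardJones lennardJones_nonpos)
open Summit.AtomisticToContinuum.Crystallization.Theorems.FrustratedLawDichotomyRangeCut
open Summit.AtomisticToContinuum.Crystallization.Theorems.FrustratedLawDichotomySchurCut
open Summit.AtomisticToContinuum.Crystallization.Theorems.FrustratedLawDichotomyMotifLemmas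
open Summit.AtomisticToContinuum.Crystallization.Theorems.FrustratedLawDichotomyAveragingCut
open Summit.AtomisticToContinuum.Crystallization.Theorems.FrustratedLawDichotomyAveragingRuleCap
open Summit.AtomisticToContinuum.Crystallization.Theorems.FrustratedLawDichotomyAveragingRuleTightFree
open Summit.AtomisticToContinuum.Crystallization.Theorems.FrustratedLawDichotomyRuleToolkitGood (goodFlag)
open Summit.AtomisticToContinuum.Crystallization.Theorems.FrustratedLawDichotomyExemptDoor (SitePred)
open Summit.AtomisticToContinuum.Crystallization.Theorems.FrustratedLawDichotomyExemptAbsorption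
open Summit.AtomisticToContinuum.Crystallization.Theorems.FrustratedLawDichotomyExemptAbsorptionRecord
open Summit.AtomisticToContinuum.Crystallization.Theorems.FrustratedLawDichotomyCollarCensus
open Summit.AtomisticToContinuum.Crystallization.Theorems.FrustratedLawDichotomyCollarCensusKappa
open Summit.AtomisticToContinuum.Crystallization.Theorems.FrustratedLawDichotomyStrainedPatchHomSplit
open Summit.AtomisticToContinuum.Crystallization.Theorems.FrustratedLawDichotomyStrainedPatchCleanCollar
open Summit.AtomisticToContinuum.Crystallization.Theorems.FrustratedLawDichotomyStrainedPatchHomTube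
open Summit.AtomisticToContinuum.Crystallization.Theorems.FrustratedLawDichotomyStrainedPatchHomIsometry
open Summit.AtomisticToContinuum.Crystallization.Theorems.FrustratedLawDichotomyStrainedPatchHomTubeIso
open Summit.AtomisticToContinuum.Crystallization.Theorems.FrustratedLawDichotomyStrainedPatchPhaseCut
open Summit.AtomisticToContinuum.Crystallization.Theorems.FrustratedLawDichotomyStrainedPatchCoreTube

/-! ## §3. The bridge at the core radius: the far tail is signed, the homogeneous floor survives truncation, core relief, seams -/

/-- **Sign of the record potential beyond the bump**: `W₄₅ t ≤ 0` for `t ≥ 8/5` (`W₄₅ = V·(1 − w₄₅)` there, `V ≤ 0` on `[1, ∞)`, `0 ≤ w₄₅ ≤ 1`, `ω₄ = 0`).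
[folklore; `lennardJones_nonpos` = BlancLewin2015 §1.1 (3)] -/
theorem effPot45_nonpos {t : ℝ} (ht : 8 / 5 ≤ t) : effPot w₄₅ ω₄ (3 / 400) t ≤ 0 := by
  have hω : ω₄ t = 0 := omega₂_of_two_le (by linarith)
  have hV : lennardJones t ≤ 0 := lennardJones_nonpos (by linarith)
  have hw : 0 ≤ 1 - w₄₅ t := by linarith [(w₄₅_mem t).2]
  simp only [effPot, corePot, hω, mul_zero, sub_zero]
  exact mul_nonpos_of_nonpos_of_nonneg hV hw

/-- ★ **THE FAR TAIL IS SIGNED**: for `R ≥ 17/5 = 9/5 + 8/5` every far pair term of a member is `≤ 0`, so `tailOut R M z c j ≤ 0` for every member `j`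
(`dist (z j) (z c) ≤ 9/5`; the partner `k` beyond `R` of the centre is at distance `≥ R − 9/5 ≥ 8/5` from `j`). [folklore] -/
theorem tailOut_nonpos_of_mem {R : ℝ} (hR : 17 / 5 ≤ R) {M : ℕ} (z : Fin M → E3) (c j : Fin M) (hj : dist (z j) (z c) ≤ 9 / 5) :
    tailOut R M z c j ≤ 0 := by
  unfold tailOut
  have hs : (∑ k : Fin M, if R < dist (z k) (z c) then effPot w₄₅ ω₄ (3 / 400) (dist (z j) (z k)) else 0) ≤ 0 := by
    refine Finset.sum_nonpos fun k _ => ?_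
    split_ifs with hk
    · refine effPot45_nonpos ?_
      have htri := dist_triangle (z k) (z j) (z c)
      rw [dist_comm (z k) (z j)] at htri
      linarith
    · exact le_rfl
  linarith

/-- Hence the members' ball average of the far tail is `≤ 0` (on EVERY cluster, admissible or not). [folklore] -/
theorem ballAvg_tailOut_nonpos {R : ℝ} (hR : 17 / 5 ≤ R) {M : ℕ} (z : Fin M → E3) (c : Fin M) :
    ballAvg (9 / 5) z (tailOut R M z c) c ≤ 0 := by
  unfold ballAvg
  exact Finset.sum_nonpos fun j hj => div_nonpos_of_nonpos_of_nonneg (tailOut_nonpos_of_mem hR z c j (mem_ball.1 hj)) (Nat.cast_nonneg _)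

/-- The far tail is isometry-invariant. [formal bookkeeping] -/
theorem tailOut_comp (R' : E3 ≃ₗᵢ[ℝ] E3) {R : ℝ} {M : ℕ} (z : Fin M → E3) (c j : Fin M) :
    tailOut R M (⇑R' ∘ z) c j = tailOut R M z c j := by
  simp only [tailOut, Function.comp_apply, LinearIsometryEquiv.dist_map]

/-- **`HomCoreFloor ρ m` [CERT; the (H) programme on the truncated functional]** — on every admissible homogeneous instance the members' ball average of the CORE
functional `x_j − tailOut ρ` is `≥ m` (float at `ρ = 24/5`: hcp floor instance `2.597e-3`, fcc `4.082e-3`). -/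
def HomCoreFloor (ρ m : ℝ) : Prop :=
  ∀ (M : ℕ) (z : Fin M → E3) (c : Fin M), Admissible M z c → IsHomBall (133 / 10) z c →
    m ≤ ballAvg (9 / 5) z (fun j => xRec M z j - tailOut ρ M z c j) c

/-- ★ **(H) SURVIVES TRUNCATION**: `HomFloor m → HomCoreFloor ρ m` for `ρ ≥ 17/5` (the discarded tail is `≤ 0`). [folklore] -/
theorem homCoreFloor_of_homFloor {ρ m : ℝ} (hρ : 17 / 5 ≤ ρ) (h : HomFloor m) : HomCoreFloor ρ m := by
  intro M z c hz hhom
  have h1 := h M z c hz hhom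
  have h2 := ballAvg_tailOut_nonpos hρ z c
  rw [ballAvg_core_add_tail (R := ρ) z c] at h1
  linarith

/-- Where the core floor sits: with the tail penalty it gives the homogeneous floor back, `μ` lower. [folklore] -/
theorem homFloor_of_homCoreFloor_of_tailPenalty {ρ m μ : ℝ} (hC : HomCoreFloor ρ m) (hT : TailPenalty ρ μ) : HomFloor (m - μ) := by
  intro M z c hz hhom
  have h1 := hC M z c hz hhom
  have h2 := hT M z c hz
  rw [ballAvg_core_add_tail (R := ρ) z c]
  linarith

/-- **`CoreCoreRelief r r₁ ρ ε A` [PERTURBATIVE: force-capped linear response INSIDE the core tube]** — on admissible clusters clean within `r`, of one word out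
to `r₁`, whose `ρ`-core is `ε`-near-affine modulo isometry, SOME admissible homogeneous instance has CORE value (`ballAvg` of `x_j − tailOut ρ`) at most `A`
above the cluster's CORE value. -/
def CoreCoreRelief (r r₁ ρ ε A : ℝ) : Prop :=
  ∀ (M : ℕ) (z : Fin M → E3) (c : Fin M), Admissible M z c → CleanBall r z c → MonoPhaseBall r₁ z c → NearHomIsoAt ρ ε z c →
    ∃ (M₀ : ℕ) (z₀ : Fin M₀ → E3) (c₀ : Fin M₀), Admissible M₀ z₀ c₀ ∧ IsHomBall (133 / 10) z₀ c₀ ∧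
      ballAvg (9 / 5) z₀ (fun j => xRec M₀ z₀ j - tailOut ρ M₀ z₀ c₀ j) c₀ - A ≤
        ballAvg (9 / 5) z (fun j => xRec M z j - tailOut ρ M z c j) c

/-- The core relief is monotone in `A` and antitone in `ε`. [folklore] -/
theorem CoreCoreRelief.mono {r r₁ ρ ε A A' : ℝ} (h : CoreCoreRelief r r₁ ρ ε A) (hle : A ≤ A') : CoreCoreRelief r r₁ ρ ε A' := by
  intro M z c hz hcl hm hn
  obtain ⟨M₀, z₀, c₀, h₀, hhom, hv⟩ := h M z c hz hcl hm hn
  exact ⟨M₀, z₀, c₀, h₀, hhom, by linarith⟩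

/-- Monotonicity bookkeeping (`CoreCoreRelief.anti`). -/
theorem CoreCoreRelief.anti {r r₁ ρ ε ε' A : ℝ} (h : CoreCoreRelief r r₁ ρ ε A) (hle : ε' ≤ ε) : CoreCoreRelief r r₁ ρ ε' A :=
  fun M z c hz hcl hm hn => h M z c hz hcl hm (hn.mono hle)

/-- ★ **SEAM AT THE CORE RADIUS**: `HomCoreFloor ρ m → TailPenalty ρ μ → CoreCoreRelief r r₁ ρ ε A → φ + A + μ ≤ m → MonoCoreTubeFloor r r₁ ρ ε φ`
(`S(z) = core(z) + tail(z) ≥ (core(z₀) − A) − μ ≥ m − A − μ`). [folklore: additivity of `ballAvg` + three inequalities] -/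
theorem monoCoreTubeFloor_of_homCoreFloor_of_tailPenalty_of_coreRelief {r r₁ ρ ε m μ A φ : ℝ} (hH : HomCoreFloor ρ m) (hT : TailPenalty ρ μ)
    (hR : CoreCoreRelief r r₁ ρ ε A) (hm : φ + A + μ ≤ m) : MonoCoreTubeFloor r r₁ ρ ε φ := by
  intro M z c hz hcl hmono hn
  obtain ⟨M₀, z₀, c₀, h₀, hhom, hle⟩ := hR M z c hz hcl hmono hn
  have h1 := hH M₀ z₀ c₀ h₀ hhom
  have h2 := hT M z c hz
  rw [ballAvg_core_add_tail (R := ρ) z c]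
  linarith

/-- ★ … and from (H) itself for `ρ ≥ 17/5`: `HomFloor m → TailPenalty ρ μ → CoreCoreRelief r r₁ ρ ε A → φ + A + μ ≤ m → MonoCoreTubeFloor r r₁ ρ ε φ`. [folklore] -/
theorem monoCoreTubeFloor_of_homFloor_of_tailPenalty_of_coreRelief {r r₁ ρ ε m μ A φ : ℝ} (hρ : 17 / 5 ≤ ρ) (hH : HomFloor m) (hT : TailPenalty ρ μ)
    (hR : CoreCoreRelief r r₁ ρ ε A) (hm : φ + A + μ ≤ m) : MonoCoreTubeFloor r r₁ ρ ε φ :=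
  monoCoreTubeFloor_of_homCoreFloor_of_tailPenalty_of_coreRelief (homCoreFloor_of_homFloor hρ hH) hT hR hm

/-- Where the core relief sits: the core-tube piece and a witness instance give it back (`core(z) ≥ S(z)` by the signed tail, `ρ ≥ 17/5`). [folklore] -/
theorem coreCoreRelief_of_monoCoreTubeFloor_of_witness {r r₁ ρ ε φ A : ℝ} (hρ : 17 / 5 ≤ ρ) (h : MonoCoreTubeFloor r r₁ ρ ε φ) {M₀ : ℕ}
    {z₀ : Fin M₀ → E3} {c₀ : Fin M₀} (h₀ : Admissible M₀ z₀ c₀) (hhom : IsHomBall (133 / 10) z₀ c₀)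
    (hval : ballAvg (9 / 5) z₀ (fun j => xRec M₀ z₀ j - tailOut ρ M₀ z₀ c₀ j) c₀ ≤ φ + A) : CoreCoreRelief r r₁ ρ ε A := by
  intro M z c hz hcl hm hn
  refine ⟨M₀, z₀, c₀, h₀, hhom, ?_⟩
  have h1 := h M z c hz hcl hm hn
  have h2 := ballAvg_tailOut_nonpos hρ z c
  rw [ballAvg_core_add_tail (R := ρ) z c] at h1
  linarith

/-- The tree's clean-core floor (`…CleanCollar` §7) gives the core tube outright (`ρ ≤ r`): `CleanCoreFloor ρ ν → TailPenalty ρ μ → φ + μ ≤ ν → MonoCoreTubeFloor r r₁ ρ ε φ`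
— recorded to place the new piece: the core tube asks for the core floor only NEAR the homogeneous instances. [folklore] -/
theorem monoCoreTubeFloor_of_cleanCoreFloor_of_tailPenalty {r r₁ ρ ε ν μ φ : ℝ} (hρ : ρ ≤ r) (hC : CleanCoreFloor ρ ν) (hT : TailPenalty ρ μ)
    (hm : φ + μ ≤ ν) : MonoCoreTubeFloor r r₁ ρ ε φ := by
  intro M z c hz hcl _ _
  have h1 := hC M z c hz (hcl.mono hρ)
  have h2 := hT M z c hz
  rw [ballAvg_core_add_tail (R := ρ) z c]
  linarith

/-! ## §4. The nodes -/

/-- ★ FOUR-PIECE PURE-STACKING / ELASTIC NODE by the core tube (`r₁ ≤ r₂`, floors `≥ 0`):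
`MonoCoreTubeFloor r r₂ ρ ε φ₀ → CoreOffTubeFloor r r₂ ρ ε φ₁ → AnnularPhaseFloor r r₁ r₂ φ₂ → PolyTextureFloor r r₁ φ₃ → CleanTextureFloor r`. [folklore] -/
theorem cleanTextureFloor_of_coreTube_of_coreOff_of_annularPhase_of_poly {r r₁ r₂ ρ ε φ₀ φ₁ φ₂ φ₃ : ℝ} (hT : MonoCoreTubeFloor r r₂ ρ ε φ₀)
    (hC : CoreOffTubeFloor r r₂ ρ ε φ₁) (hF : AnnularPhaseFloor r r₁ r₂ φ₂) (hP : PolyTextureFloor r r₁ φ₃) (hle : r₁ ≤ r₂) (h₀ : 0 ≤ φ₀)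
    (h₁ : 0 ≤ φ₁) (h₂ : 0 ≤ φ₂) (h₃ : 0 ≤ φ₃) : CleanTextureFloor r :=
  (cleanTextureFloorAt_iff_three_phases hle).2 ⟨monoTextureFloor_zero_of_coreTube_of_coreOff hT hC h₀ h₁, hF.of_le h₂, hP.of_le h₃⟩

/-- ★★ THE NODE (record radii `r = r₂ = 63/10`, `r₁ = 24/5`; any core radius `ρ`, tube width `ε`, floors `≥ 0`):
`MonoCoreTubeFloor → CoreOffTubeFloor → AnnularPhaseFloor → PolyTextureFloor → AnnularDefectFloor (24/5) (63/10) → DefectiveCollarFloor (24/5) → StrainedPatchRec`. [folklore] -/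
theorem strainedPatchRec_of_coreTube_of_coreOff_of_annularPhase_of_poly_of_annular_of_near {ρ ε φ₀ φ₁ φ₂ φ₃ : ℝ}
    (hT : MonoCoreTubeFloor (63 / 10) (63 / 10) ρ ε φ₀) (hC : CoreOffTubeFloor (63 / 10) (63 / 10) ρ ε φ₁)
    (hF : AnnularPhaseFloor (63 / 10) (24 / 5) (63 / 10) φ₂) (hP : PolyTextureFloor (63 / 10) (24 / 5) φ₃) (h₀ : 0 ≤ φ₀) (h₁ : 0 ≤ φ₁)
    (h₂ : 0 ≤ φ₂) (h₃ : 0 ≤ φ₃) (hA : AnnularDefectFloor (24 / 5) (63 / 10)) (hD : DefectiveCollarFloor (24 / 5)) : StrainedPatchRec :=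
  strainedPatchRec_iff_record_regimes.2
    ⟨cleanTextureFloor_of_coreTube_of_coreOff_of_annularPhase_of_poly hT hC hF hP (by norm_num) h₀ h₁ h₂ h₃, hA, hD⟩

/-- ★★ THE NODE WITH THE BRIDGE (`ρ ≥ 17/5`, floors `≥ 0`; NO `TubeRelief`, NO rim piece):
`HomFloor m → TailPenalty ρ μ → CoreCoreRelief (63/10) (63/10) ρ ε A → A + μ ≤ m → CoreOffTubeFloor (63/10) (63/10) ρ ε φ₁ → AnnularPhaseFloor … φ₂ →
PolyTextureFloor … φ₃ → AnnularDefectFloor (24/5) (63/10) → DefectiveCollarFloor (24/5) → StrainedPatchRec`. [folklore] -/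
theorem strainedPatchRec_of_homFloor_of_tailPenalty_of_coreRelief_of_coreOff_of_annularPhase_of_poly_of_annular_of_near
    {ρ ε m μ A φ₁ φ₂ φ₃ : ℝ} (hρ : 17 / 5 ≤ ρ) (hH : HomFloor m) (hT : TailPenalty ρ μ) (hR : CoreCoreRelief (63 / 10) (63 / 10) ρ ε A)
    (hm : A + μ ≤ m) (hC : CoreOffTubeFloor (63 / 10) (63 / 10) ρ ε φ₁) (hF : AnnularPhaseFloor (63 / 10) (24 / 5) (63 / 10) φ₂)
    (hP : PolyTextureFloor (63 / 10) (24 / 5) φ₃) (h₁ : 0 ≤ φ₁) (h₂ : 0 ≤ φ₂) (h₃ : 0 ≤ φ₃) (hA : AnnularDefectFloor (24 / 5) (63 / 10))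
    (hD : DefectiveCollarFloor (24 / 5)) : StrainedPatchRec :=
  strainedPatchRec_of_coreTube_of_coreOff_of_annularPhase_of_poly_of_annular_of_near
    (monoCoreTubeFloor_of_homFloor_of_tailPenalty_of_coreRelief (φ := 0) hρ hH hT hR (by linarith)) hC hF hP le_rfl h₁ h₂ h₃ hA hD

/-- ★★ … the same from the truncated certificate `HomCoreFloor ρ m` (any `ρ`). [folklore] -/
theorem strainedPatchRec_of_homCoreFloor_of_tailPenalty_of_coreRelief_of_coreOff_of_annularPhase_of_poly_of_annular_of_near
    {ρ ε m μ A φ₁ φ₂ φ₃ : ℝ} (hH : HomCoreFloor ρ m) (hT : TailPenalty ρ μ) (hR : CoreCoreRelief (63 / 10) (63 / 10) ρ ε A) (hm : A + μ ≤ m)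
    (hC : CoreOffTubeFloor (63 / 10) (63 / 10) ρ ε φ₁) (hF : AnnularPhaseFloor (63 / 10) (24 / 5) (63 / 10) φ₂)
    (hP : PolyTextureFloor (63 / 10) (24 / 5) φ₃) (h₁ : 0 ≤ φ₁) (h₂ : 0 ≤ φ₂) (h₃ : 0 ≤ φ₃) (hA : AnnularDefectFloor (24 / 5) (63 / 10))
    (hD : DefectiveCollarFloor (24 / 5)) : StrainedPatchRec :=
  strainedPatchRec_of_coreTube_of_coreOff_of_annularPhase_of_poly_of_annular_of_near
    (monoCoreTubeFloor_of_homCoreFloor_of_tailPenalty_of_coreRelief (φ := 0) hH hT hR (by linarith)) hC hF hP le_rfl h₁ h₂ h₃ hA hD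

/-- Arithmetic of record: `A + μ = 3/5000 + 1/1000 ≤ 1/625 = m`. [formal bookkeeping] -/
theorem seam_arith_core : (3 : ℝ) / 5000 + 1 / 1000 ≤ 1 / 625 := by norm_num

/-- ★★ RECORD NODE (record literals `ρ = 24/5`, `ε = 1/100`, `m = 1/625`, `μ = 1/1000`, `A = 3/5000`; the residual / phase floors `1/1000` PROVISIONAL):
`HomFloor (1/625) → TailPenalty (24/5) (1/1000) → CoreCoreRelief (63/10) (63/10) (24/5) (1/100) (3/5000) → CoreOffTubeFloor (63/10) (63/10) (24/5) (1/100) (1/1000) →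
AnnularPhaseFloor (63/10) (24/5) (63/10) (1/1000) → PolyTextureFloor (63/10) (24/5) (1/1000) → AnnularDefectFloor (24/5) (63/10) → DefectiveCollarFloor (24/5) → StrainedPatchRec`. -/
theorem strainedPatchRec_of_homFloor_625_of_tailPenalty_milli_of_coreRelief_of_coreOff_of_annularPhase_of_poly_of_annular_of_near
    (hH : HomFloor (1 / 625)) (hT : TailPenalty (24 / 5) (1 / 1000)) (hR : CoreCoreRelief (63 / 10) (63 / 10) (24 / 5) (1 / 100) (3 / 5000))
    (hC : CoreOffTubeFloor (63 / 10) (63 / 10) (24 / 5) (1 / 100) (1 / 1000)) (hF : AnnularPhaseFloor (63 / 10) (24 / 5) (63 / 10) (1 / 1000))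
    (hP : PolyTextureFloor (63 / 10) (24 / 5) (1 / 1000)) (hA : AnnularDefectFloor (24 / 5) (63 / 10)) (hD : DefectiveCollarFloor (24 / 5)) :
    StrainedPatchRec :=
  strainedPatchRec_of_homFloor_of_tailPenalty_of_coreRelief_of_coreOff_of_annularPhase_of_poly_of_annular_of_near (by norm_num) hH hT hR
    seam_arith_core hC hF hP (by norm_num) (by norm_num) (by norm_num) hA hD

/-- ★★ … and as the `h1` hypothesis of `…CollarCensusZeroFree.aperiodicFrustratedLawGap_of_collarPiecesKK_milli_unionT_zero_free`. -/
theorem strainedPatch_of_homFloor_625_of_tailPenalty_milli_of_coreRelief_of_coreOff_of_annularPhase_of_poly_of_annular_of_near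
    (hH : HomFloor (1 / 625)) (hT : TailPenalty (24 / 5) (1 / 1000)) (hR : CoreCoreRelief (63 / 10) (63 / 10) (24 / 5) (1 / 100) (3 / 5000))
    (hC : CoreOffTubeFloor (63 / 10) (63 / 10) (24 / 5) (1 / 100) (1 / 1000)) (hF : AnnularPhaseFloor (63 / 10) (24 / 5) (63 / 10) (1 / 1000))
    (hP : PolyTextureFloor (63 / 10) (24 / 5) (1 / 1000)) (hA : AnnularDefectFloor (24 / 5) (63 / 10)) (hD : DefectiveCollarFloor (24 / 5)) :
    StrainedPatchMotifPricingCapXK (1 / 1000) (9 / 5) (133 / 10) (3 / 2) (effPot w₄₅ ω₄ (3 / 400)) (-(7175 / 10000) + 3 / 400)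
      (Collar (9 / 2) fun N y j => (∃ s : ℝ, 0 ≤ s ∧ s ≤ 3 / 2 ∧ NonEquilibriumCore (-(7175 / 10000)) 0 7 s (1 / 10000) N y j) ∨
        GoodAtScale (1 / 20) (3 / 2) y j) :=
  strainedPatch_iff.1
    (strainedPatchRec_of_homFloor_625_of_tailPenalty_milli_of_coreRelief_of_coreOff_of_annularPhase_of_poly_of_annular_of_near hH hT hR hC hF hP hA hD)

/-- ★★ THE SPLIT OF RECORD fed into g46's record node (the rim kept as a separate piece; `TubeRelief` discharges g46's tube):
`HomFloor (1/625) → TubeRelief (63/10) (1/100) 0 (1/1000) → CoreOffTubeFloor (63/10) (63/10) (24/5) (1/100) (1/1000) → RimOffTubeFloor (63/10) (63/10) (24/5) (1/100) (63/10) (1/100) (1/1000)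
→ AnnularPhaseFloor … (1/1000) → PolyTextureFloor … (1/1000) → AnnularDefectFloor (24/5) (63/10) → DefectiveCollarFloor (24/5) → StrainedPatchRec`. -/
theorem strainedPatchRec_of_homFloor_625_of_tubeRelief_milli_of_coreOff_of_rim_of_annularPhase_of_poly_of_annular_of_near
    (hH : HomFloor (1 / 625)) (hR : TubeRelief (63 / 10) (1 / 100) 0 (1 / 1000)) (hC : CoreOffTubeFloor (63 / 10) (63 / 10) (24 / 5) (1 / 100) (1 / 1000))
    (hRim : RimOffTubeFloor (63 / 10) (63 / 10) (24 / 5) (1 / 100) (63 / 10) (1 / 100) (1 / 1000))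
    (hF : AnnularPhaseFloor (63 / 10) (24 / 5) (63 / 10) (1 / 1000)) (hP : PolyTextureFloor (63 / 10) (24 / 5) (1 / 1000))
    (hA : AnnularDefectFloor (24 / 5) (63 / 10)) (hD : DefectiveCollarFloor (24 / 5)) : StrainedPatchRec :=
  strainedPatchRec_of_homFloor_625_of_tubeRelief_milli_of_monoOffTube_of_annularPhase_of_poly_of_annular_of_near hH hR
    (monoOffTubeFloor_of_coreOff_of_rim (by norm_num) le_rfl hC hRim) hF hP hA hD

/-- g46's record node follows from the core-tube one with `ρ = 63/10` (nothing proved before is lost): its `[OT-G]` is `CoreOffTubeFloor … (63/10) …` and its tube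
`MonoTubeFloor` is `MonoCoreTubeFloor … (63/10) … 0`. [formal bookkeeping] -/
theorem strainedPatchRec_of_phaseCut_record (hH : HomFloor (1 / 625)) (hR : TubeRelief (63 / 10) (1 / 100) 0 (1 / 1000))
    (hG : MonoOffTubeFloor (63 / 10) (63 / 10) (1 / 100) (1 / 1000)) (hF : AnnularPhaseFloor (63 / 10) (24 / 5) (63 / 10) (1 / 1000))
    (hP : PolyTextureFloor (63 / 10) (24 / 5) (1 / 1000)) (hA : AnnularDefectFloor (24 / 5) (63 / 10)) (hD : DefectiveCollarFloor (24 / 5)) :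
    StrainedPatchRec :=
  strainedPatchRec_of_coreTube_of_coreOff_of_annularPhase_of_poly_of_annular_of_near
    ((monoCoreTubeFloor_record_iff (63 / 10) (63 / 10) (1 / 100)).2 (monoTubeFloor_of_homFloor_of_tubeRelief hH hR seam_arith_tube))
    ((coreOffTubeFloor_record_iff (63 / 10) (63 / 10) (1 / 100) (1 / 1000)).2 hG) hF hP le_rfl (by norm_num) (by norm_num) (by norm_num) hA hD

end Summit.AtomisticToContinuum.Crystallization.Theorems.FrustratedLawDichotomyStrainedPatchCoreTubeRecord
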